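import Summits.BirchSwinnertonDyer.Rank1Residual.Additive.GordCharLeadingTerm
import Summits.BirchSwinnertonDyer.Rank1Residual.Additive.GordThreeDelbourgo2002Bridge
import Summits.BirchSwinnertonDyer.Rank1Residual.Additive.N10LowerHalfIwasawa
import Summits.BirchSwinnertonDyer.Rank1Residual.Additive.X4MThreeUpperHalfTowerFree
import Summits.BirchSwinnertonDyer.Rank1Residual.AdditivePotMult.RankZeroThreeTwistFacts
import HarnessLib

/-!
# (G)-ordinary at `p = 3`, rank `0`: the Λ-currency LOWER input reduced to Miller's currency over
# Delbourgo 2002 at `3` — the `p = 3` twin of additive-p2's `GordCharLeadingTerm` core and of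
# cc-typer-2's `N10.missingLowerBoundAt_of_cycLowerLeadingTerm_of_nonAnomalous`
# (cell `b2b-bsdres`, team n1011, seat p16; row T-b2c-BR, discharged here per n1011-p18 / lead R3-24)

HONEST FRAMING (cell `b2b-bsdres`, run/shared/lean/b2b/bsd-rank1-residual/, verbatim in every
file): the goal of the cell is to DELETE the COMBINATION-SHAPED residual classes of the
Birch–Swinnerton-Dyer formula for ALL analytic-rank `≤ 1` elliptic curves over `ℚ` — "full BSD
formula for every rank `≤ 1` curve in class `C`" assembled STRICTLY from published theorems — so
that the rank-`≤ 1` remainder becomes exactly the CONSTRUCTION-SHAPED classes, which are TYPED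
(missing-input `Prop`s), NOT attempted. This is not "finishing BSD". Team n1011 (N10 / N11):
research route; prove what is provable now; no claim beyond the stated classes; X3♯(G-ord) /
X4♯(G-ord) stay CONSTRUCTION-SHAPED; labels UNCHANGED; nothing booked. Theorems only (no definition,
no named fact minted; the one Literature input is the explicit binder `hDel3 : Delbourgo2002.mainTheorem_three`).

## What and why

The N11 block's (G)-ordinary share at `3` ((G-ord)@3 = Kodaira `I₀*` with ordinary twist; 16 517 S-b
rank-`0` pairs, RESIDUAL-MAP §I N11) has its UPPER half in the kernel (additive-p2's `ω`-branch chain,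
n1011-p14's certificate-free tower) and its LOWER half typed ONCE in Iwasawa currency at `T = 0`
(`Additive.CycLowerLeadingTermAt`, the decl of record; element-wise twin `CycLeadingTermDvdAt`,
n1011-p18, `cycLeadingTermDvdAt_iff_cycLowerLeadingTermAt`). At `p ≥ 5` the reduction "Λ-currency
lower input ⟹ Miller's `MissingLowerBoundAt`" runs through Delbourgo 2002 (A)+(B) = A175
(additive-p2 `exists_padicVal_shaAn_of_cycLowerLeadingTerm`; cc-typer-2
`N10.missingLowerBoundAt_of_cycLowerLeadingTerm_of_nonAnomalous`), whose `5 ≤ p` left "`p = 3`" in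
the Miller-currency complement (`N10LowerHalfIwasawa` docstring). With `Delbourgo2002.mainTheorem_three`
(this seat) and the bridge `TypeGOrd.delbourgo2002_three` (`GordThreeDelbourgo2002Bridge`), the
same reduction holds AT `3`:

* `exists_padicVal_shaAn_of_constantCoeff_eq_of_clauses` — additive-p2's rank-`0` core with the named
  fact's two OUTPUTS ((A) torsion for the datum, (B) `LeadingTermClauses W p Dh`) as hypotheses, any
  prime: `#Ш_an = q' ∈ ℚ^×`, `ord_p q' + ord_p c = ord_p #Ш + ord_p ℓ` (`c` the cofactor of the
  generator's constant term over `L(E,1)/Ω_E`, `ℓ ∣ p²`, `ℓ = 1` off the anomalous rows) — so A175,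
  A190 and the `p = 3` fact share one proof;
* `TypeGOrd.exists_padicVal_shaAn_three_of_cycLowerLeadingTerm` — on `TypeGOrd W 3 ∧ Addv W 3`,
  non-CM, `r_an = 0`: `CycLowerLeadingTermAt W 3` ⟹ that identity at `3`;
* `TypeGOrd.missingLowerBoundAt_three_rankZero_of_cycLower_of_nonAnomalous` — OFF the anomalous rows
  (`ReductionNonAnomalous W 3`, `ℓ = 1`): `Typed.MissingLowerBoundAt W 3`. On the anomalous (G-ord)@3
  rows the slack `ℓ ∣ 9` remains (flag `Del02-ThmB-ellp-anomalous`), exactly as at `p ≥ 5`.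

Class-level Miller-currency forms (`N10.CellGordTwo` at `3`, `ClassX4Gord`/`ClassX3Gord` wrappers,
the iff with `CycLeadingTermDvdAt`) are cc-typer-2's / n1011-p18's one-liners over these three and are
not written here (one owner per statement). Nothing booked; no label change.

References: D. Delbourgo, J. Number Theory 95 (2002) Theorem (A), (B) (p. 40), Hypothesis (p. 39),
ℓ_p(E) (p. 39, p. 69) [Delbourgo2002]; D. Delbourgo, Compositio Math. 113 (1998) Main Conjecture
(p. 151) (shape of the typed input) [Delbourgo1998]; R. L. Miller, LMS J. Comput. Math. 14 (2011)
Def. 1.1 [Miller2011LMS].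
-/

noncomputable section

open scoped Classical NumberField

open WeierstrassCurve NumberField IsDedekindDomain
  Literature.NumberTheory.EllipticCurves
  Literature.NumberTheory.EllipticCurves.ModularForms
  Literature.NumberTheory.EllipticCurves.Rank1Residual
  Literature.NumberTheory.EllipticCurves.Rank1Residual.Typed

namespace Summit.BirchSwinnertonDyer.Rank1Residual.Additive

open AdditivePotMult

variable (W : WeierstrassCurve ℚ) [W.IsElliptic] [W.IsGloballyMinimal] (p : ℕ) [hp : Fact p.Prime]

/-- **Core, data level, fact-agnostic** (rank `0`, any prime): from the two CONCLUSIONS of Delbourgo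
2002 at the pair — `X` torsion for the datum (`hX`) and the leading-term clauses for some height
datum (`hB`) — and a generator `f` of `char_Λ X` with `f(0) = c · q`, `L(E,1) = q · Ω_E`:
`#Ш_an = q' ∈ ℚ^×`, `c ≠ 0`, `ord_p q' + ord_p c = ord_p #Ш + ord_p ℓ`, `ℓ ∣ p²`, `ℓ = 1` off the
anomalous rows (additive-p2's `exists_padicVal_shaAn_of_constantCoeff_eq`, gen 18, with the named
fact's outputs as hypotheses so that A175 / A190 / the `p = 3` fact share one proof).
[cite: Delbourgo2002, Theorem (A), (B) (p. 40)] -/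
theorem exists_padicVal_shaAn_of_constantCoeff_eq_of_clauses
    (hGZK : rank_eq_analyticRank_of_analyticRank_le_one) (hmod : hasEntireLFunction_rat)
    (hr : W.analyticRank = 0)
    {κ : ZpExtension ℚ p} {γ : Field.absoluteGaloisGroup ℚ}
    (hκ : κ.IsCyclotomic) (hγ : κ.IsTopGenerator γ) (hγ' : IsCyclotomicVariable p γ)
    (D : W.SelmerDualData κ γ) (hX : D.IsTorsion)
    {Dh : PAdicHeightData W p} (hB : Delbourgo2002.LeadingTermClauses W p Dh)
    {f : IwasawaAlgebra p} (hf : D.charIdeal = Ideal.span {f})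
    {q : ℚ} (hLq : W.entireLFunction 1 = (q : ℂ) * (W.realPeriodRat : ℂ))
    {c : ℤ_[p]} (hf0 : ((PowerSeries.constantCoeff f : ℤ_[p]) : ℚ_[p]) = (c : ℚ_[p]) * (q : ℚ_[p])) :
    ∃ q' : ℚ, shaAn W = (q' : ℂ) ∧ q' ≠ 0 ∧ c ≠ 0 ∧
      ∃ ℓ : ℕ, ℓ ∣ p ^ 2 ∧ (Delbourgo2002.ReductionNonAnomalous W p → ℓ = 1) ∧
        padicValRat p q' + ((c : ℤ_[p]) : ℚ_[p]).valuation =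
          padicValNat p W.shaOrder + padicValNat p ℓ := by
  classical
  have hpP : p.Prime := hp.out
  have hL : W.entireLFunction 1 ≠ 0 := (W.analyticRank_eq_zero_iff_holds (hmod W)).mp hr
  obtain ⟨hmw, hfin⟩ := hGZK W (by rw [hr]; exact zero_le_one)
  have hmw0 : W.mordellWeilRank = 0 := by rw [hmw, hr]
  haveI : Finite W.sha := hfin
  haveI hE : Finite W.toAffine.Point := W.finite_point_of_rank_zero hmw0
  have hfinp : Finite (AddCommGroup.primaryComponent W.sha p) :=
    Finite.of_injective _ Subtype.val_injective
  haveI : Module.Finite (IwasawaAlgebra p) D.X :=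
    SelmerDualData.module_finite_of_isCyclotomic (W := W) (κ := κ) hκ D hγ
  obtain ⟨-, u, ℓ, hℓp, hℓ1, heq⟩ := hB.constantCoeff hκ hγ hγ' D hX hf hfinp
  have hΩ : (W.realPeriodRat : ℂ) ≠ 0 := by exact_mod_cast W.realPeriodRat_pos_holds.ne'
  have hq' : W.entireLFunction 1 / (W.realPeriodRat : ℂ) = (q : ℂ) := by
    rw [hLq, mul_div_cancel_right₀ _ hΩ]
  obtain ⟨-, -, -, hshaAn⟩ := Wuthrich2014.shaAn_eq_of_L_one_div_eq hGZK W hL hq'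
  have hq0 : q ≠ 0 := by
    intro h0
    apply hL
    rw [hLq, h0, Rat.cast_zero, zero_mul]
  set T : ℕ := Nat.card W.toAffine.Point with hT
  have hTtors : W.torsionOrder = T := (W.natCard_point_eq_torsionOrder).symm
  have hT0 : T ≠ 0 := by rw [hT]; exact Nat.card_pos.ne'
  have hTam : 0 < W.tamagawaProduct := W.tamagawaProduct_pos_holds
  have hS0 : Nat.card (AddCommGroup.primaryComponent W.sha p) ≠ 0 := Nat.card_pos.ne'
  have hℓ0 : ℓ ≠ 0 := by
    rintro rfl
    exact pow_ne_zero 2 hpP.ne_zero (Nat.eq_zero_of_zero_dvd hℓp)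
  have hsha : padicValNat p (Nat.card (AddCommGroup.primaryComponent W.sha p)) =
      padicValNat p W.shaOrder := by
    unfold WeierstrassCurve.shaOrder
    exact padicValNat_card_addPrimaryComponent p
  have hkey : (c : ℚ_[p]) * (q : ℚ_[p]) * ((T : ℕ) : ℚ_[p]) ^ 2 =
      ((u : ℤ_[p]) : ℚ_[p]) * (ℓ : ℚ_[p]) *
        ((Nat.card (AddCommGroup.primaryComponent W.sha p) : ℚ_[p]) * (W.tamagawaProduct : ℚ_[p])) := by
    rw [← hf0, ← heq, hTtors]
  obtain ⟨hc0, hval⟩ := padicVal_bookkeeping (p := p) u hq0 hT0 hS0 hTam.ne' hℓ0 hkey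
  rw [hsha] at hval
  have hTq : (T : ℚ) ≠ 0 := by exact_mod_cast hT0
  have hPq : (W.tamagawaProduct : ℚ) ≠ 0 := by exact_mod_cast hTam.ne'
  exact ⟨q * (T : ℚ) ^ 2 / (W.tamagawaProduct : ℚ), by rw [hshaAn],
    div_ne_zero (mul_ne_zero hq0 (pow_ne_zero 2 hTq)) hPq, hc0, ℓ, hℓp, hℓ1, hval⟩

variable {W p}

/-- **(G-ord)@3 core from the typed LOWER divisibility** — the `p = 3` twin of additive-p2's
`exists_padicVal_shaAn_of_cycLowerLeadingTerm` (`p ≥ 5`, A175), over the `p = 3` fact: on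
`TypeGOrd W 3 ∧ Addv W 3`, non-CM, `r_an = 0`, `CycLowerLeadingTermAt W 3` gives `#Ш_an = q ∈ ℚ^×` with
`ord₃ q + ord₃ c = ord₃ #Ш + ord₃ ℓ`, `c ∈ ℤ₃ ∖ {0}`, `ℓ ∣ 9`, `ℓ = 1` off the anomalous rows.
[cite: Delbourgo2002, Theorem (A), (B) (p. 40), Hypothesis (p. 39)] -/
theorem TypeGOrd.exists_padicVal_shaAn_three_of_cycLowerLeadingTerm [Fact (Nat.Prime 3)]
    (hDel3 : Delbourgo2002.mainTheorem_three)
    (hGZK : rank_eq_analyticRank_of_analyticRank_le_one) (hmod : hasEntireLFunction_rat)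
    (hG : TypeGOrd W 3) (hadd : Addv W 3) (hcm : ¬ W.HasCM) (hr : W.analyticRank = 0)
    (hLow : CycLowerLeadingTermAt W 3) :
    ∃ q : ℚ, shaAn W = (q : ℂ) ∧ q ≠ 0 ∧
      ∃ (c : ℤ_[3]) (ℓ : ℕ), c ≠ 0 ∧ ℓ ∣ 3 ^ 2 ∧ (Delbourgo2002.ReductionNonAnomalous W 3 → ℓ = 1) ∧
        padicValRat 3 q + ((c : ℤ_[3]) : ℚ_[3]).valuation = padicValNat 3 W.shaOrder + padicValNat 3 ℓ := by
  obtain ⟨hA, Dh, hB⟩ := hG.delbourgo2002_three hDel3 hadd hcm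
  obtain ⟨κ, γ, hκ, hγ, hγ', D, f, hf⟩ := exists_cyclotomic_dualData_generator W 3
  obtain ⟨q, hLq, c, hf0⟩ := hLow κ γ hκ hγ hγ' D f hf
  obtain ⟨q', hq', hq'0, hc0, ℓ, hℓp, hℓ1, hval⟩ :=
    exists_padicVal_shaAn_of_constantCoeff_eq_of_clauses W 3 hGZK hmod hr hκ hγ hγ' D
      (hA κ γ hκ hγ D) hB hf hLq hf0
  exact ⟨q', hq', hq'0, c, ℓ, hc0, hℓp, hℓ1, hval⟩

/-- **(G-ord)@3, rank `0`, OFF the anomalous rows: the LOWER half from the decl of record at `p = 3`**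
— the `p = 3` twin of cc-typer-2's `N10.missingLowerBoundAt_of_cycLowerLeadingTerm_of_nonAnomalous`
(which needs `5 ≤ p` only through A175). [cite: Delbourgo2002, Theorem (A), (B) (p. 40)] [cite: Miller2011LMS, Def. 1.1] -/
theorem TypeGOrd.missingLowerBoundAt_three_rankZero_of_cycLower_of_nonAnomalous [Fact (Nat.Prime 3)]
    (hDel3 : Delbourgo2002.mainTheorem_three)
    (hGZK : rank_eq_analyticRank_of_analyticRank_le_one) (hmod : hasEntireLFunction_rat)
    (hG : TypeGOrd W 3) (hadd : Addv W 3) (hcm : ¬ W.HasCM) (hr : W.analyticRank = 0)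
    (hna : Delbourgo2002.ReductionNonAnomalous W 3) (hLow : CycLowerLeadingTermAt W 3) :
    MissingLowerBoundAt W 3 := by
  obtain ⟨q, hq, -, c, ℓ, -, -, hℓ1, hval⟩ :=
    hG.exists_padicVal_shaAn_three_of_cycLowerLeadingTerm hDel3 hGZK hmod hadd hcm hr hLow
  have hc : 0 ≤ ((c : ℤ_[3]) : ℚ_[3]).valuation := PadicInt.valuation_coe_nonneg
  rw [hℓ1 hna, padicValNat_one_right, Nat.cast_zero, add_zero] at hval
  exact ⟨q, hq, by linarith⟩


/-! ### §2 (APPEND 2026-08-21, row T-b2c-BR, lead R4-3) Consequences at `3`: the element-wise input,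
the anomalous slack, class forms, and `BSD(E,3)` from the LOWER divisibility alone -/

/-- **Same, from n1011-p18's element-wise input `CycLeadingTermDvdAt W 3`** (equivalent to the decl of
record; cc-typer-2's bridge `N10.cycLowerLeadingTermAt_of_cycLeadingTermDvdAt`).
[cite: Delbourgo2002, Theorem (A), (B) (p. 40)] [cite: Miller2011LMS, Def. 1.1] -/
theorem TypeGOrd.missingLowerBoundAt_three_rankZero_of_cycLeadingTermDvd_of_nonAnomalous
    [Fact (Nat.Prime 3)] (hDel3 : Delbourgo2002.mainTheorem_three)
    (hGZK : rank_eq_analyticRank_of_analyticRank_le_one) (hmod : hasEntireLFunction_rat)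
    (hG : TypeGOrd W 3) (hadd : Addv W 3) (hcm : ¬ W.HasCM) (hr : W.analyticRank = 0)
    (hna : Delbourgo2002.ReductionNonAnomalous W 3) (hDvd : CycLeadingTermDvdAt W 3) :
    MissingLowerBoundAt W 3 :=
  hG.missingLowerBoundAt_three_rankZero_of_cycLower_of_nonAnomalous hDel3 hGZK hmod hadd hcm hr hna
    (N10.cycLowerLeadingTermAt_of_cycLeadingTermDvdAt W 3 hDvd)

/-- **On EVERY (G-ord)@3 row (anomalous included) the slack is at most `2`**: `#Ш_an = q` with
`ord₃ q ≤ ord₃ #Ш(E) + 2` (`ℓ ∣ 9`) — the `p = 3` twin of cc-typer-2's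
`N10.padicValRat_shaAn_le_add_two_of_cycLowerLeadingTerm`. [cite: Delbourgo2002, Theorem (A), (B) (p. 40), ℓ_p(E) (p. 39)] -/
theorem TypeGOrd.padicValRat_shaAn_le_add_two_three_of_cycLower [Fact (Nat.Prime 3)]
    (hDel3 : Delbourgo2002.mainTheorem_three)
    (hGZK : rank_eq_analyticRank_of_analyticRank_le_one) (hmod : hasEntireLFunction_rat)
    (hG : TypeGOrd W 3) (hadd : Addv W 3) (hcm : ¬ W.HasCM) (hr : W.analyticRank = 0)
    (hLow : CycLowerLeadingTermAt W 3) :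
    ∃ q : ℚ, shaAn W = (q : ℂ) ∧ padicValRat 3 q ≤ padicValNat 3 W.shaOrder + 2 := by
  obtain ⟨q, hq, -, c, ℓ, -, hℓp, -, hval⟩ :=
    hG.exists_padicVal_shaAn_three_of_cycLowerLeadingTerm hDel3 hGZK hmod hadd hcm hr hLow
  have hc : 0 ≤ ((c : ℤ_[3]) : ℚ_[3]).valuation := PadicInt.valuation_coe_nonneg
  have hvℓ : padicValNat 3 ℓ ≤ 2 :=
    (Nat.pow_dvd_pow_iff_le_right (by norm_num : 1 < 3)).mp (pow_padicValNat_dvd.trans hℓp)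
  have hvℓ' : (padicValNat 3 ℓ : ℤ) ≤ 2 := by exact_mod_cast hvℓ
  exact ⟨q, hq, by linarith⟩

/-- **X4♯(G-ord) at `3`, rank `0`, non-CM, OFF the anomalous rows: the LOWER half ⟸ the lower
divisibility of Delbourgo's MC at `T = 0`.** [cite: Delbourgo2002, Theorem (A), (B) (p. 40)] [cite: Miller2011LMS, Def. 1.1] -/
theorem ClassX4Gord.missingLowerBoundAt_three_rankZero_of_cycLower_of_nonAnomalous [Fact (Nat.Prime 3)]
    (hDel3 : Delbourgo2002.mainTheorem_three)
    (hGZK : rank_eq_analyticRank_of_analyticRank_le_one) (hmod : hasEntireLFunction_rat)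
    (hX : ClassX4Gord W 3) (hcm : ¬ W.HasCM) (hr : W.analyticRank = 0)
    (hna : Delbourgo2002.ReductionNonAnomalous W 3) (hLow : CycLowerLeadingTermAt W 3) :
    MissingLowerBoundAt W 3 :=
  hX.typeGOrd.missingLowerBoundAt_three_rankZero_of_cycLower_of_nonAnomalous hDel3 hGZK hmod hX.addv.2
    hcm hr hna hLow

/-- **X3♯(G-ord) at `3`, rank `0`, non-CM, OFF the anomalous rows: the LOWER half ⟸ the lower
divisibility** (reducible `E[3]`: the source has no image hypothesis).
[cite: Delbourgo2002, Theorem (A), (B) (p. 40)] [cite: Miller2011LMS, Def. 1.1] -/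
theorem ClassX3Gord.missingLowerBoundAt_three_rankZero_of_cycLower_of_nonAnomalous [Fact (Nat.Prime 3)]
    (hDel3 : Delbourgo2002.mainTheorem_three)
    (hGZK : rank_eq_analyticRank_of_analyticRank_le_one) (hmod : hasEntireLFunction_rat)
    (hX : ClassX3Gord W 3) (hcm : ¬ W.HasCM) (hr : W.analyticRank = 0)
    (hna : Delbourgo2002.ReductionNonAnomalous W 3) (hLow : CycLowerLeadingTermAt W 3) :
    MissingLowerBoundAt W 3 :=
  hX.typeGOrd.missingLowerBoundAt_three_rankZero_of_cycLower_of_nonAnomalous hDel3 hGZK hmod hX.addv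
    hcm hr hna hLow

/-- **X4♯(G-ord) at `3` ∧ surj(3), rank `0`, non-CM, non-anomalous: `BSD(E,3)` ⟸ the LOWER divisibility
of Delbourgo's MC (G) at `T = 0` ALONE** — the upper half being additive-p2's `ω`-branch chain with
n1011-p14's certificate-free tower (`ClassX4Gord.bsdp_three_of_katoComponent_of_surj_of_lower`:
Kato's branch-component reading `hK`, Delbourgo Prop. 4 `hDel`, GZK, modularity). On the (G-ord)@3
share of N11 (non-anomalous, non-CM rows) the missing input is `X_D1` at `T = 0`, lower direction,
and NOTHING ELSE. [cite: Delbourgo2002, Theorem (A), (B) (p. 40)] [cite: Kato2004Asterisque, Thm. 17.4 (3) (p. 273)]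
[cite: Delbourgo1998, Prop. 4 (p. 144)] [cite: Miller2011LMS, §1 and Def. 1.1] -/
theorem ClassX4Gord.bsdp_three_rankZero_of_cycLower_of_nonAnomalous_of_surj [Fact (Nat.Prime 3)]
    (hDel3 : Delbourgo2002.mainTheorem_three)
    (hK : Kato2004.charIdeal_dvd_padicLFunctionBranch_component_of_surjective)
    (hDel : Delbourgo1998.prop4_rankZero_pow_dvd_constantCoeff)
    (hGZK : rank_eq_analyticRank_of_analyticRank_le_one) (hmod : hasEntireLFunction_rat)
    (hmodD : nonempty_modularParametrizationData)
    (hX : ClassX4Gord W 3) (hcm : ¬ W.HasCM) (hr : W.analyticRank = 0) (hsurj : Surj W 3)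
    (hna : Delbourgo2002.ReductionNonAnomalous W 3) (hLow : CycLowerLeadingTermAt W 3) : BSDp W 3 :=
  ClassX4Gord.bsdp_three_of_katoComponent_of_surj_of_lower hK hDel hGZK hmod hmodD hX hr hsurj
    (ClassX4Gord.missingLowerBoundAt_three_rankZero_of_cycLower_of_nonAnomalous hDel3 hGZK hmod hX hcm
      hr hna hLow)

/-- **X3♯(G-ord) at `3`, rank `0`, non-CM, non-anomalous: `BSD(E,3)` ⟸ the LOWER divisibility ALONE**
— the upper half being additive-p1's reducible-twist chain at `3` (`ClassX3Gord.missingUpperBoundAt_three_rankZero`: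
Wuthrich 2014 Thm. 16 `ω`-component `hW16`, Delbourgo Prop. 4 `hDel`, GZK, modularity; defect `2` is
automatic at `3`). [cite: Delbourgo2002, Theorem (A), (B) (p. 40)] [cite: Wuthrich2014, Thm. 16 (p. 397)]
[cite: Delbourgo1998, Prop. 4 (p. 144)] [cite: Miller2011LMS, §1 and Def. 1.1] -/
theorem ClassX3Gord.bsdp_three_rankZero_of_cycLower_of_nonAnomalous [Fact (Nat.Prime 3)]
    (hDel3 : Delbourgo2002.mainTheorem_three)
    (hW16 : Wuthrich2014.thm16_minusEigenCharIdeal_dvd_cyclotomicThree)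
    (hDel : Delbourgo1998.prop4_rankZero_pow_dvd_constantCoeff)
    (hGZK : rank_eq_analyticRank_of_analyticRank_le_one) (hmod : hasEntireLFunction_rat)
    (hmodD : nonempty_modularParametrizationData)
    (hX : ClassX3Gord W 3) (hcm : ¬ W.HasCM) (hr : W.analyticRank = 0)
    (hna : Delbourgo2002.ReductionNonAnomalous W 3) (hLow : CycLowerLeadingTermAt W 3) : BSDp W 3 :=
  bsdp_of_missingPPartAt W 3 hGZK (by rw [hr]; exact zero_le_one)
    (missingPPartAt_of_lower_of_upper W 3
      (ClassX3Gord.missingLowerBoundAt_three_rankZero_of_cycLower_of_nonAnomalous hDel3 hGZK hmod hX hcm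
        hr hna hLow)
      (AdditivePotMult.ClassX3Gord.missingUpperBoundAt_three_rankZero hDel hGZK hmod hmodD hW16 hX
        (semistabilityIndex_eq_two_of_typeG_three W hX.typeGOrd.typeG hX.addv) hr))

end Summit.BirchSwinnertonDyer.Rank1Residual.Additive

end
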